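import Mathlib.CategoryTheory.CofilteredSystem
import Mathlib.Algebra.Group.Hom.Defs
import Mathlib.Order.Directed
import HarnessLib

/-!
# Kőnig's lemma for inverse systems of finite sets / finite abelian groups over a DIRECTED index
# set, carrier-free: a compatible family of maps that kills every compatible thread vanishes at
# some level

Topic `Algebra/InverseSystem`; namespace `Literature.Algebra.InverseSystem`; THEOREMS ONLY (no
definition, no named fact, no `sorry`).  Currency of `DirectedSystemLifting.lean`: an inverse system
is EXPLICIT DATA — types (or additive groups) `X i` over a directed preorder `ι` and transition maps
`T h : X j → X i` for `h : i ≤ j`, functorial (`T le_rfl = id`, `T hij ∘ T hjk = T (hij.trans hjk)`);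
a family `x : Π i, X i` is COMPATIBLE ("a thread", Atiyah–Macdonald Ch. 10 "coherent sequence")
when `T h (x j) = x i` for all `i ≤ j`.  No limit object is formed.

* §1 `exists_compatible_mem_of_finite` — **Kőnig / compactness**: finite non-empty subsets
  `F i ⊆ X i` stable under the transition maps admit a compatible thread inside them (Mathlib's
  `nonempty_sections_of_finite_inverse_system`, unbundled; Bourbaki, *Topologie générale* I §9 no. 6
  Prop. 8 / *Theory of Sets* III §7 no. 4 Thm. 1: "a projective limit of non-empty finite sets is
  non-empty"; Ribes–Zalesskii, *Profinite Groups*, Prop. 1.1.4).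
* §2 `exists_forall_of_forall_compatible_exists` — the CONTRAPOSITIVE form in which the lemma is
  consumed: for FINITE `X i` and a property `P i` on `X i` that DESCENDS along the transitions
  (`P i (T h x) → P j x`), if every compatible thread satisfies `P` at some level, then at some
  level `P i` holds identically.
* §3 additive form `exists_addMonoidHom_eq_zero_of_forall_compatible_exists`: finite additive groups
  `S i`, additive transition maps, a COMPATIBLE family of homomorphisms `λ i : S i →+ C`
  (`λ i ∘ T h = λ j`); if every compatible thread `y` has `λ i (y i) = 0` at some level — in
  particular (`…_of_compatible_eq_zero`) if the only compatible thread is `0`, i.e. "`lim_i S i = 0`"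
  — then `λ i = 0` for some `i`, hence for all `j ≥ i` (`…_eventually_…`).
* §4 the same for `ℕ`-TOWERS given by one-step maps `t m : S (m+1) →+ S m` (the currency of
  `AddInverseLimit.lean`, `addInverseLimit t`): `exists_addMonoidHom_eq_zero_of_tower`.

## Why (where this is used)

The passage "`S_{𝓛*}(K, T*) = lim_m S*_m = 0` ⟹ some finite-level pairing functional
`λ_m : S*_m → ℚ/ℤ` vanishes" in Λ-adic surjectivity arguments for the global-to-local map defining a
Selmer group (Greenberg, Kyoto J. Math. 50 (2010) Prop. 3.2.1: the finite-level Poitou–Tate lift is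
applied at the level `m` where `λ_m = 0`); more generally any "`lim = 0` ⟹ levelwise vanishing of a
compatible functional on finite stages" step.  Nothing is asserted about any arithmetic object.
A twin of §1 restricted to the `SemiGraph` namespace exists in the tree
(`Literature.AnabelianGeometry.SemiGraphs.SemiGraph.exists_compatible_of_finite`); §1 is restated here
in the generic inverse-system topic so that algebra files need not import the anabelian library.

References: [AtiyahMacdonald1969] Ch. 10 (inverse systems, coherent sequences);
[RibesZalesskii2010] Prop. 1.1.4; [Bourbaki TG I §9.6 Prop. 8]; [Greenberg2010] Prop. 3.2.1.
-/

namespace Literature.Algebra.InverseSystem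

universe u v w

open Function CategoryTheory

/-! ### §1 Kőnig's lemma, unbundled -/

section Konig

variable {ι : Type u} [Preorder ι] [IsDirectedOrder ι] {X : ι → Type v}
  (T : ∀ ⦃i j : ι⦄, i ≤ j → X j → X i)

/-- **Kőnig's lemma / compactness for inverse systems of finite sets** over a directed index order:
finite non-empty subsets `F i ⊆ X i` stable under functorial transition maps `T h : X j → X i`
(`i ≤ j`) contain a compatible thread.  Unbundled from Mathlib's
`nonempty_sections_of_finite_inverse_system`. [cite: RibesZalesskii2010, Prop. 1.1.4]
[cite: AtiyahMacdonald1969, Ch. 10 p. 103] -/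
theorem exists_compatible_mem_of_finite
    (T_id : ∀ (i : ι) (x : X i), T le_rfl x = x)
    (T_comp : ∀ ⦃i j k : ι⦄ (hij : i ≤ j) (hjk : j ≤ k) (x : X k),
      T hij (T hjk x) = T (hij.trans hjk) x)
    (F : ∀ i, Set (X i)) (hfin : ∀ i, (F i).Finite) (hne : ∀ i, (F i).Nonempty)
    (hmap : ∀ ⦃i j : ι⦄ (h : i ≤ j) (x : X j), x ∈ F j → T h x ∈ F i) :
    ∃ x : ∀ i, X i, (∀ i, x i ∈ F i) ∧ ∀ ⦃i j : ι⦄ (h : i ≤ j), T h (x j) = x i := by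
  let D : ιᵒᵖ ⥤ Type v :=
    { obj := fun j => F j.unop
      map := fun {a b} h => TypeCat.ofHom fun x => ⟨T (leOfHom h.unop) x.1, hmap _ _ x.2⟩
      map_id := fun a => ConcreteCategory.hom_ext _ _ fun x => Subtype.ext (T_id _ _)
      map_comp := fun {a b c} h h' =>
        ConcreteCategory.hom_ext _ _ fun x => Subtype.ext (T_comp _ _ _).symm }
  haveI : ∀ j : ιᵒᵖ, Finite (D.obj j) := fun j => (hfin j.unop).to_subtype
  haveI : ∀ j : ιᵒᵖ, Nonempty (D.obj j) := fun j => (hne j.unop).to_subtype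
  obtain ⟨s, hs⟩ := nonempty_sections_of_finite_inverse_system D
  refine ⟨fun j => (s (Opposite.op j)).1, fun j => (s (Opposite.op j)).2, fun i j h => ?_⟩
  have h1 : D.map ((homOfLE h).op) (s (Opposite.op j)) = s (Opposite.op i) :=
    @hs (Opposite.op j) (Opposite.op i) (homOfLE h).op
  exact congrArg Subtype.val h1

/-! ### §2 The contrapositive form: a descending property holds identically at some level -/

/-- **Levelwise validity from validity on threads.**  Let the `X i` be FINITE and let `P i` be a
property on `X i` which DESCENDS along the transition maps (`P i (T h x) → P j x` for `i ≤ j`: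
if the image satisfies it, so does the element).  If every compatible thread `x` satisfies `P i (x i)`
at SOME level `i`, then there is a level `i` at which `P i` holds for every element of `X i`.
(Otherwise the failure sets `{x | ¬ P i x}` are finite, non-empty and stable, and Kőnig's lemma gives
a thread failing `P` everywhere.) [cite: RibesZalesskii2010, Prop. 1.1.4]
[cite: AtiyahMacdonald1969, Ch. 10 p. 103] -/
theorem exists_forall_of_forall_compatible_exists [∀ i, Finite (X i)]
    (T_id : ∀ (i : ι) (x : X i), T le_rfl x = x)
    (T_comp : ∀ ⦃i j k : ι⦄ (hij : i ≤ j) (hjk : j ≤ k) (x : X k),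
      T hij (T hjk x) = T (hij.trans hjk) x)
    {P : ∀ i, X i → Prop} (hP : ∀ ⦃i j : ι⦄ (h : i ≤ j) (x : X j), P i (T h x) → P j x)
    (hthread : ∀ x : ∀ i, X i, (∀ ⦃i j : ι⦄ (h : i ≤ j), T h (x j) = x i) → ∃ i, P i (x i)) :
    ∃ i, ∀ x : X i, P i x := by
  by_contra hcon
  push Not at hcon
  obtain ⟨x, hxF, hxc⟩ := exists_compatible_mem_of_finite T T_id T_comp (fun i => {x | ¬ P i x})
    (fun i => Set.toFinite _) (fun i => hcon i) (fun i j h x hx hPx => hx (hP h x hPx))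
  obtain ⟨i, hi⟩ := hthread x hxc
  exact hxF i hi

/-- The same with the conclusion propagated upwards: `P j` holds identically at every `j ≥ i`.
[cite: AtiyahMacdonald1969, Ch. 10 p. 103] -/
theorem exists_forall_ge_forall_of_forall_compatible_exists [∀ i, Finite (X i)]
    (T_id : ∀ (i : ι) (x : X i), T le_rfl x = x)
    (T_comp : ∀ ⦃i j k : ι⦄ (hij : i ≤ j) (hjk : j ≤ k) (x : X k),
      T hij (T hjk x) = T (hij.trans hjk) x)
    {P : ∀ i, X i → Prop} (hP : ∀ ⦃i j : ι⦄ (h : i ≤ j) (x : X j), P i (T h x) → P j x)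
    (hthread : ∀ x : ∀ i, X i, (∀ ⦃i j : ι⦄ (h : i ≤ j), T h (x j) = x i) → ∃ i, P i (x i)) :
    ∃ i, ∀ j, i ≤ j → ∀ x : X j, P j x := by
  obtain ⟨i, hi⟩ := exists_forall_of_forall_compatible_exists T T_id T_comp hP hthread
  exact ⟨i, fun j hij x => hP hij x (hi (T hij x))⟩

end Konig

/-! ### §3 Additive form: a compatible family of homomorphisms killing every thread vanishes at
some level -/

section Additive

variable {ι : Type u} [Preorder ι] [IsDirectedOrder ι] {S : ι → Type v}
  [∀ i, AddCommGroup (S i)] [∀ i, Finite (S i)]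
  (T : ∀ ⦃i j : ι⦄, i ≤ j → S j →+ S i) {C : Type w} [AddCommGroup C] (lam : ∀ i, S i →+ C)

/-- **A compatible family of homomorphisms `λ i : S i →+ C` on an inverse system of FINITE abelian
groups which kills every compatible thread at some level vanishes identically at some level.**
Compatibility: `λ i (T h y) = λ j y` for `i ≤ j`. [cite: Greenberg2010, Prop. 3.2.1 (p. 15)]
[cite: AtiyahMacdonald1969, Ch. 10 p. 103] -/
theorem exists_addMonoidHom_eq_zero_of_forall_compatible_exists
    (T_id : ∀ (i : ι) (y : S i), T le_rfl y = y)
    (T_comp : ∀ ⦃i j k : ι⦄ (hij : i ≤ j) (hjk : j ≤ k) (y : S k),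
      T hij (T hjk y) = T (hij.trans hjk) y)
    (hlam : ∀ ⦃i j : ι⦄ (h : i ≤ j) (y : S j), lam i (T h y) = lam j y)
    (hthread : ∀ y : ∀ i, S i, (∀ ⦃i j : ι⦄ (h : i ≤ j), T h (y j) = y i) →
      ∃ i, lam i (y i) = 0) :
    ∃ i, lam i = 0 := by
  obtain ⟨i, hi⟩ := exists_forall_of_forall_compatible_exists (fun i j h => ⇑(T h)) T_id T_comp
    (P := fun i y => lam i y = 0) (fun i j h y hy => by rwa [hlam h y] at hy) hthread
  exact ⟨i, AddMonoidHom.ext hi⟩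

/-- **If the inverse limit is trivial — the only compatible thread is `0` — then a compatible
family of homomorphisms out of the finite stages vanishes at some level.**
[cite: Greenberg2010, Prop. 3.2.1 (p. 15)] [cite: AtiyahMacdonald1969, Ch. 10 p. 103] -/
theorem exists_addMonoidHom_eq_zero_of_compatible_eq_zero [Nonempty ι]
    (T_id : ∀ (i : ι) (y : S i), T le_rfl y = y)
    (T_comp : ∀ ⦃i j k : ι⦄ (hij : i ≤ j) (hjk : j ≤ k) (y : S k),
      T hij (T hjk y) = T (hij.trans hjk) y)
    (hlam : ∀ ⦃i j : ι⦄ (h : i ≤ j) (y : S j), lam i (T h y) = lam j y)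
    (hlim : ∀ y : ∀ i, S i, (∀ ⦃i j : ι⦄ (h : i ≤ j), T h (y j) = y i) → ∀ i, y i = 0) :
    ∃ i, lam i = 0 := by
  obtain ⟨i₀⟩ := ‹Nonempty ι›
  exact exists_addMonoidHom_eq_zero_of_forall_compatible_exists T lam T_id T_comp hlam
    fun y hy => ⟨i₀, by rw [hlim y hy i₀, map_zero]⟩

/-- Eventual form: under the hypotheses of `exists_addMonoidHom_eq_zero_of_forall_compatible_exists`,
`λ j = 0` for every `j` above some level `i`. [cite: Greenberg2010, Prop. 3.2.1 (p. 15)]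
[cite: AtiyahMacdonald1969, Ch. 10 p. 103] -/
theorem exists_forall_ge_addMonoidHom_eq_zero_of_forall_compatible_exists
    (T_id : ∀ (i : ι) (y : S i), T le_rfl y = y)
    (T_comp : ∀ ⦃i j k : ι⦄ (hij : i ≤ j) (hjk : j ≤ k) (y : S k),
      T hij (T hjk y) = T (hij.trans hjk) y)
    (hlam : ∀ ⦃i j : ι⦄ (h : i ≤ j) (y : S j), lam i (T h y) = lam j y)
    (hthread : ∀ y : ∀ i, S i, (∀ ⦃i j : ι⦄ (h : i ≤ j), T h (y j) = y i) →
      ∃ i, lam i (y i) = 0) :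
    ∃ i, ∀ j, i ≤ j → lam j = 0 := by
  obtain ⟨i, hi⟩ := exists_addMonoidHom_eq_zero_of_forall_compatible_exists T lam T_id T_comp
    hlam hthread
  refine ⟨i, fun j hij => AddMonoidHom.ext fun y => ?_⟩
  rw [← hlam hij y, hi, AddMonoidHom.zero_apply, AddMonoidHom.zero_apply]

end Additive

/-! ### §4 `ℕ`-towers given by one-step transition maps -/

section Tower

variable {S : ℕ → Type v} [∀ m, AddCommGroup (S m)] [∀ m, Finite (S m)]
  (t : ∀ m, S (m + 1) →+ S m) {C : Type w} [AddCommGroup C] (lam : ∀ m, S m →+ C)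

omit [∀ m, Finite (S m)] in
/-- Iterated transition maps of a tower, with their two defining equations (auxiliary; no
definition is introduced — the iterate is produced existentially by `Nat.leRec`). [folklore] -/
private theorem exists_iterate :
    ∃ T : ∀ ⦃i j : ℕ⦄, i ≤ j → S j →+ S i,
      (∀ (i : ℕ) (y : S i), T le_rfl y = y) ∧
      (∀ ⦃i k : ℕ⦄ (h : i ≤ k) (h' : i ≤ k + 1) (y : S (k + 1)), T h' y = T h (t k y)) := by
  refine ⟨fun i j h => Nat.leRec (motive := fun j _ => S j →+ S i) (AddMonoidHom.id (S i))
    (fun k _ f => f.comp (t k)) h, fun i y => ?_, fun i k h h' y => ?_⟩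
  · simp only [Nat.leRec_self, AddMonoidHom.id_apply]
  · dsimp only
    rw [Nat.leRec_succ (h1 := h)]
    rfl

/-- **Tower form.**  For an `ℕ`-tower of FINITE abelian groups `⋯ → S (m+1) —t m→ S m → ⋯` and a
family of homomorphisms `λ m : S m →+ C` compatible with the one-step maps
(`λ m ∘ t m = λ (m+1)`): if every compatible sequence `(y m)` (`t m (y (m+1)) = y m`, i.e. every
element of `addInverseLimit t`) has `λ m (y m) = 0` at some level, then `λ m = 0` for some `m`, and
then for all larger `m`. [cite: Greenberg2010, Prop. 3.2.1 (p. 15)]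
[cite: AtiyahMacdonald1969, Ch. 10 Prop. 10.2] -/
theorem exists_addMonoidHom_eq_zero_of_tower (hlam : ∀ (m : ℕ) (y : S (m + 1)), lam m (t m y) = lam (m + 1) y)
    (hthread : ∀ y : ∀ m, S m, (∀ m, t m (y (m + 1)) = y m) → ∃ m, lam m (y m) = 0) :
    ∃ m, ∀ n, m ≤ n → lam n = 0 := by
  obtain ⟨T, T_self, T_succ⟩ := exists_iterate t
  -- functoriality of the iterates
  have T_comp : ∀ ⦃i j k : ℕ⦄ (hij : i ≤ j) (hjk : j ≤ k) (y : S k),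
      T hij (T hjk y) = T (hij.trans hjk) y := by
    intro i j k hij hjk
    induction k, hjk using Nat.le_induction with
    | base => intro y; rw [T_self]
    | succ k hjk ih =>
      intro y
      rw [T_succ hjk (Nat.le_succ_of_le hjk) y, ih (t k y),
        ← T_succ (hij.trans hjk) (hij.trans (Nat.le_succ_of_le hjk)) y]
  -- compatibility of `λ` with the iterates
  have hlamT : ∀ ⦃i j : ℕ⦄ (h : i ≤ j) (y : S j), lam i (T h y) = lam j y := by
    intro i j h
    induction j, h using Nat.le_induction with
    | base => intro y; rw [T_self]
    | succ k hik ih => intro y; rw [T_succ hik (Nat.le_succ_of_le hik) y, ih (t k y), hlam]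
  -- threads for the iterates are exactly the compatible sequences of the tower
  have hthreadT : ∀ y : ∀ m, S m, (∀ ⦃i j : ℕ⦄ (h : i ≤ j), T h (y j) = y i) →
      ∃ m, lam m (y m) = 0 := fun y hy =>
    hthread y fun m => by
      have := hy (Nat.le_succ m)
      rwa [T_succ le_rfl (Nat.le_succ m), T_self] at this
  exact exists_forall_ge_addMonoidHom_eq_zero_of_forall_compatible_exists T lam T_self T_comp
    hlamT hthreadT

/-- **Tower form, trivial limit**: if the only compatible sequence of the tower of finite groups is
`0` ("`lim_m S m = 0`", `addInverseLimit t = ⊥`), every compatible family of homomorphisms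
`λ m : S m →+ C` vanishes from some level on. [cite: Greenberg2010, Prop. 3.2.1 (p. 15)]
[cite: AtiyahMacdonald1969, Ch. 10 Prop. 10.2] -/
theorem exists_addMonoidHom_eq_zero_of_tower_of_compatible_eq_zero
    (hlam : ∀ (m : ℕ) (y : S (m + 1)), lam m (t m y) = lam (m + 1) y)
    (hlim : ∀ y : ∀ m, S m, (∀ m, t m (y (m + 1)) = y m) → ∀ m, y m = 0) :
    ∃ m, ∀ n, m ≤ n → lam n = 0 :=
  exists_addMonoidHom_eq_zero_of_tower t lam hlam fun y hy => ⟨0, by rw [hlim y hy 0, map_zero]⟩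

end Tower

end Literature.Algebra.InverseSystem
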